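import Mathlib
import HarnessLib

/-!
# Crux `Target` = `TypeICertificateLadder.NoTypeIBlowup` (stmt-NavierStokesRegularity-1217), line
# `depletion-ladder`: a barrier lemma for the logistic integral inequality

`--supports stmt-NavierStokesRegularity-1217` (line `depletion-ladder`; real-analysis tool for the slab
form of the Lamb–energy slack, `Theorems/TypeICertificateLadderTargetLambEnergySlack.lean`).

If `z(t) = z(0) + ∫₀ᵗ φ` on `[0, S]` with `φ` integrable and `φ ≤ a z − b z²` on `(0, S)` (`a ≥ 0`,
`b > 0`), then `z ≤ max(z(0), a/b)` on `[0, S]`: above the carrying capacity `a/b` the right-hand side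
is negative, so `z` cannot cross any level `K' > max(z(0), a/b)` upward (a continuity/connectedness
argument on `[0, S]`, `IsClosed.Icc_subset_of_forall_mem_nhdsWithin`). Applied with `z = ‖∇u‖₂²`,
`a = ‖u‖²_∞/(2ν)`, `b = 2ν/‖u₀‖₂²` it turns the logistic enstrophy slice inequality into the uniform
bound `‖∇u(t)‖₂² ≤ max(‖∇u(0)‖₂², ‖u‖²_∞‖u₀‖₂²/(4ν²))`. Elementary. [folklore]
-/

noncomputable section

open Set Filter Topology MeasureTheory

namespace Summit.NavierStokesRegularity.NavierStokesRegularity.Theorems.DepletionLadder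

-- the problem directory repeats the summit name (`NavierStokesRegularity/NavierStokesRegularity`)
set_option linter.dupNamespace false

/-- **Barrier for the logistic integral inequality.** Let `z(t) = z(0) + ∫₀ᵗ φ` for `t ∈ [0, S]`,
with `φ` integrable on `(0, S)` and `φ(t) ≤ a·z(t) − b·z(t)²` for `t ∈ (0, S)`, where `a ≥ 0`, `b > 0`.
Then `z(t) ≤ max (z 0) (a/b)` for all `t ∈ [0, S]`. [folklore] -/
theorem le_max_of_logistic_integral_ineq {z φ : ℝ → ℝ} {S a b : ℝ} (hS : 0 < S) (ha : 0 ≤ a)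
    (hb : 0 < b) (hφ : IntegrableOn φ (Ioo 0 S))
    (hz : ∀ t ∈ Icc 0 S, z t = z 0 + ∫ τ in (0 : ℝ)..t, φ τ)
    (hineq : ∀ t ∈ Ioo 0 S, φ t ≤ a * z t - b * z t ^ 2) :
    ∀ t ∈ Icc 0 S, z t ≤ max (z 0) (a / b) := by
  set K : ℝ := max (z 0) (a / b) with hK
  -- integrability on the closed interval and continuity of `z`
  have hφI : IntegrableOn φ (Icc 0 S) := (integrableOn_Icc_iff_integrableOn_Ioo (f := φ) (a := 0) (b := S)).2 hφ
  have hII : ∀ {c d : ℝ}, c ∈ Icc 0 S → d ∈ Icc 0 S → IntervalIntegrable φ volume c d := by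
    intro c d hc hd
    refine (hφI.mono_set ?_).intervalIntegrable
    exact uIcc_subset_Icc hc hd
  have hprim : ContinuousOn (fun t => ∫ τ in (0 : ℝ)..t, φ τ) (Icc 0 S) := by
    have h := intervalIntegral.continuousOn_primitive_interval (μ := volume) (a := 0) (b := S)
      (f := φ) (by rwa [uIcc_of_le hS.le])
    rwa [uIcc_of_le hS.le] at h
  have hcont : ContinuousOn z (Icc 0 S) := by
    have h1 : ContinuousOn (fun t => z 0 + ∫ τ in (0 : ℝ)..t, φ τ) (Icc 0 S) :=
      continuousOn_const.add hprim
    exact h1.congr fun t ht => hz t ht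
  -- increments of `z`
  have hincr : ∀ {x t : ℝ}, x ∈ Icc 0 S → t ∈ Icc 0 S →
      z t - z x = ∫ τ in x..t, φ τ := by
    intro x t hx ht
    have h0 : (0 : ℝ) ∈ Icc 0 S := ⟨le_rfl, hS.le⟩
    rw [hz t ht, hz x hx, ← intervalIntegral.integral_interval_sub_left (hII h0 ht) (hII h0 hx)]
    ring
  -- every level `K' > K` is a barrier
  have hbar : ∀ K' : ℝ, K < K' → ∀ t ∈ Icc 0 S, z t ≤ K' := by
    intro K' hK' t ht
    have hK'ab : a / b < K' := (le_max_right _ _).trans_lt hK'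
    have hsub : Icc 0 S ⊆ {t | z t ≤ K'} := by
      refine IsClosed.Icc_subset_of_forall_mem_nhdsWithin ?_ ?_ ?_
      · -- closedness of `{z ≤ K'} ∩ [0, S]`
        have h := hcont.preimage_isClosed_of_isClosed isClosed_Icc (isClosed_Iic (a := K'))
        rw [inter_comm]
        exact h
      · show z 0 ≤ K'
        exact ((le_max_left _ _).trans_lt hK').le
      · rintro x ⟨hxK, hx0, hxS⟩
        change z x ≤ K' at hxK
        have hxI : x ∈ Icc 0 S := ⟨hx0, hxS.le⟩
        rw [mem_nhdsGT_iff_exists_Ioo_subset]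
        rcases lt_or_eq_of_le hxK with hlt | heq
        · -- `z x < K'`: continuity
          have hc : ContinuousWithinAt z (Icc 0 S) x := hcont x hxI
          have hev : ∀ᶠ t in 𝓝[Icc 0 S] x, z t < K' :=
            hc (Iio_mem_nhds hlt)
          rw [eventually_nhdsWithin_iff, Metric.eventually_nhds_iff] at hev
          obtain ⟨δ, hδ, hδp⟩ := hev
          refine ⟨min (x + δ) S, lt_min (by linarith) hxS, fun t ht => ?_⟩
          have htS : t < S := ht.2.trans_le (min_le_right _ _)
          have htδ : t < x + δ := ht.2.trans_le (min_le_left _ _)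
          have htI : t ∈ Icc 0 S := ⟨hx0.trans ht.1.le, htS.le⟩
          have hdist : dist t x < δ := by
            rw [Real.dist_eq, abs_lt]; constructor <;> linarith [ht.1]
          exact (hδp hdist htI).le
        · -- `z x = K' > a/b`: the right-hand side is negative nearby
          have hc : ContinuousWithinAt z (Icc 0 S) x := hcont x hxI
          have hev : ∀ᶠ t in 𝓝[Icc 0 S] x, a / b < z t :=
            hc (Ioi_mem_nhds (by rw [heq]; exact hK'ab))
          rw [eventually_nhdsWithin_iff, Metric.eventually_nhds_iff] at hev
          obtain ⟨δ, hδ, hδp⟩ := hev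
          refine ⟨min (x + δ) S, lt_min (by linarith) hxS, fun t ht => ?_⟩
          have htS : t < S := ht.2.trans_le (min_le_right _ _)
          have htδ : t < x + δ := ht.2.trans_le (min_le_left _ _)
          have htI : t ∈ Icc 0 S := ⟨hx0.trans ht.1.le, htS.le⟩
          -- `φ ≤ 0` on `(x, t]`
          have hneg : ∀ τ ∈ Ioc x t, φ τ ≤ 0 := by
            intro τ hτ
            have hτS : τ < S := hτ.2.trans_lt htS
            have hτ0 : 0 < τ := hx0.trans_lt hτ.1
            have hτI : τ ∈ Icc 0 S := ⟨hτ0.le, hτS.le⟩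
            have hdist : dist τ x < δ := by
              rw [Real.dist_eq, abs_lt]; constructor <;> linarith [hτ.1, hτ.2]
            have hzτ : a / b < z τ := hδp hdist hτI
            have hzpos : 0 < z τ := (div_nonneg ha hb.le).trans_lt hzτ
            have h1 : a < b * z τ := by rw [mul_comm]; exact (div_lt_iff₀ hb).1 hzτ
            calc φ τ ≤ a * z τ - b * z τ ^ 2 := hineq τ ⟨hτ0, hτS⟩
              _ = z τ * (a - b * z τ) := by ring
              _ ≤ 0 := mul_nonpos_of_nonneg_of_nonpos hzpos.le (by linarith)
          have hint : ∫ τ in x..t, φ τ ≤ 0 := by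
            rw [intervalIntegral.integral_of_le ht.1.le]
            exact setIntegral_nonpos measurableSet_Ioc hneg
          show z t ≤ K'
          have := hincr hxI htI
          linarith
    exact hsub ht
  -- conclusion: let `K' ↓ K`
  intro t ht
  refine le_of_forall_pos_le_add fun ε hε => ?_
  exact hbar (K + ε) (by linarith) t ht

end Summit.NavierStokesRegularity.NavierStokesRegularity.Theorems.DepletionLadder

end
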